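import Summits.CriticalPhenomena.Ising3DConformalLimit.Theses.ReflectionTwin
import Literature.Probability.LatticeModels.TwistCorrBoxLimit
import HarnessLib

/-!
# Stub `stub_replicaLowerUniform` (S4u) of line `replica-mirror` (v4) for crux `ReflectionTwin.TwinTransparency`
(stmt-CriticalPhenomena-16905)

The ALL-LOWER instance of the replica mirror in LOCALLY UNIFORM form: on configurations strictly below the plane the
folded replica correlator is the free-box critical bulk correlator at the lattice points `[wᵢ/δ]`, whose box limit is
`criticalCorr 3 k [w/δ]`; hence `ρ(δ)^k · replicaFold δ k w = rescaledCorrelator (criticalCorr 3) ρ k δ w` on that set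
and the datum's locally uniform convergence restricts to it. Upgrades the pointwise `stub_replicaLower` (p170708);
the two private identification lemmas are copied from that file.
-/

noncomputable section

namespace Summit.CriticalPhenomena.Ising3DConformalLimit.Cruxes.TwinTransparency.ReplicaMirror

open scoped BigOperators Topology Manifold Classical MeasureTheory ProbabilityTheory Matrix InnerProductSpace ComplexConjugate ContinuousMap
open Filter Set Function TopologicalSpace MeasureTheory
open Literature.Probability.LatticeModels

/-! ## The free-box bulk correlator is the untwisted twisted-box correlator (as in `…ReplicaLower.lean`) -/

/-- The free-box nearest-neighbour critical couplings `β_c(3)/2 · 𝟙{‖a - b‖₁ = 1}` of `ℤ³` (ordered pairs) are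
the tree's twist couplings with zero Burgers number, `twistCouplings L 0 0 0`. [folklore] -/
private theorem nnCouplings_eq_twistCouplings_u (L : ℕ) :
    (fun a b : ↥(box 3 L) => if (∑ i, |a.1 i - b.1 i| = 1) then criticalBeta 3 / 2 else (0:ℝ)) =
      twistCouplings L 0 0 0 := by
  funext a b
  rw [twistCouplings_zero_right]
  exact if_congr (zdGraph_adj_iff_norm_holds a.1 b.1).symm rfl rfl

/-- Hence the free-box bulk correlator IS the untwisted twisted-box correlator `twistCorr L 0 0 0 k z`. [folklore] -/
private theorem gibbsAvg_nn_eq_twistCorr_u (L k : ℕ) (z : Fin k → Site 3) :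
    PairIsing.gibbsAvg (fun a b : ↥(box 3 L) => if (∑ i, |a.1 i - b.1 i| = 1) then criticalBeta 3 / 2 else (0:ℝ))
        (fun s => ∏ i, if h : z i ∈ box 3 L then spinAt (⟨z i, h⟩ : ↥(box 3 L)) s else 0) =
      twistCorr L 0 0 0 k z := by
  rw [nnCouplings_eq_twistCouplings_u]
  rfl

/-- A restricted partition sum over a conditioning class `{s' | ∀ a, q a → s' a = s a}` is nonzero (it contains `s`,
weights are positive). [folklore] -/
private theorem sum_filter_gibbsWeight_ne_zero_u {ι : Type*} [Fintype ι] [DecidableEq ι] (c : ι → ι → ℝ)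
    (q : ι → Prop) (s : SpinConfig ι) {_ : DecidablePred fun s' : SpinConfig ι => ∀ a, q a → s' a = s a} :
    (∑ s' ∈ Finset.univ.filter (fun s' : SpinConfig ι => ∀ a, q a → s' a = s a), PairIsing.gibbsWeight c s') ≠ 0 :=
  (Finset.sum_pos (fun s' _ => PairIsing.gibbsWeight_pos c s')
    ⟨s, Finset.mem_filter.2 ⟨Finset.mem_univ s, fun _ _ => rfl⟩⟩).ne'

/-! ## The stub -/

/-- **stub_replicaLowerUniform (S4u — the all-lower instance of the replica mirror, LOCALLY UNIFORM form).** On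
configurations strictly below the plane every point is OLD, the conditional resampling factor is `Z'/Z' = 1`, and
`replicaFold δ k w` is the box limit `criticalCorr 3 k [w/δ]` of the free-box critical bulk correlator
(`tendsto_twistCorr_zero_right`, `Tendsto.limsup_eq`), so `ρ(δ)^k · replicaFold δ k w = rescaledCorrelator (criticalCorr 3) ρ k δ w`
on that set for every `δ`, and the datum's LOCALLY UNIFORM convergence (`HasPointwiseScalingLimit` is
`TendstoLocallyUniformlyOn` on `NonCoincident`) restricts to the subset (`TendstoLocallyUniformlyOn.mono`, `.congr`).
[cite: AizenmanDuminilCopinSidoraviciusCMP2015, Thm. 1.2 with Cor. 1.5 (1)] [cite: FriedliVelenik2017, Exercise 3.16] -/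
theorem stub_replicaLowerUniform :
    (fun (replicaFold : ℝ → (k : ℕ) → (Fin k → EuclideanSpace ℝ (Fin 3)) → ℝ) => ∀ (ρ : ℝ → ℝ) (S : CorrFamily 3), HasPointwiseScalingLimit (criticalCorr 3) ρ S → ∀ (k : ℕ), TendstoLocallyUniformlyOn (fun (δ : ℝ) (w : Fin k → EuclideanSpace ℝ (Fin 3)) => ρ δ ^ k * replicaFold δ k w) (S k) (𝓝[>] (0:ℝ)) (NonCoincident 3 k ∩ {w | ∀ i, w i 0 + w i 1 + w i 2 < 0})) (fun (δ : ℝ) (k : ℕ) (w : Fin k → EuclideanSpace ℝ (Fin 3)) => Filter.limsup (fun L : ℕ => (fun (L k : ℕ) (old : Fin k → Prop) (z : Fin k → Site 3) => PairIsing.gibbsAvg (fun a b : ↥(box 3 L) => if (∑ i, |a.1 i - b.1 i| = 1) then criticalBeta 3 / 2 else (0:ℝ)) (fun s => (∏ i, if old i then (if h : z i ∈ box 3 L then spinAt (⟨z i, h⟩ : ↥(box 3 L)) s else 0) else 1) * (fun (g : SpinConfig ↥(box 3 L) → ℝ) (s : SpinConfig ↥(box 3 L)) => (∑ s' ∈ Finset.univ.filter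 (fun s' : SpinConfig ↥(box 3 L) => ∀ a : ↥(box 3 L), ¬ (a.1 0 + a.1 1 + a.1 2 ≤ -1) → s' a = s a), g s' * PairIsing.gibbsWeight (fun a b : ↥(box 3 L) => if (∑ i, |a.1 i - b.1 i| = 1) then criticalBeta 3 / 2 else (0:ℝ)) s') / (∑ s' ∈ Finset.univ.filter (fun s' : SpinConfig ↥(box 3 L) => ∀ a : ↥(box 3 L), ¬ (a.1 0 + a.1 1 + a.1 2 ≤ -1) → s' a = s a), PairIsing.gibbsWeight (fun a b : ↥(box 3 L) => if (∑ i, |a.1 i - b.1 i| = 1) then criticalBeta 3 / 2 else (0:ℝ)) s')) (fun s' => ∏ i, if old i then 1 else (if h : z i ∈ box 3 L then spinAt (⟨z i, h⟩ : ↥(box 3 L)) s' else 0)) s)) L k (fun i => w i 0 + w i 1 + w i 2 ≤ 0) (fun i => latticeApprox δ ((fun v : EuclideanSpace ℝ (Fin 3) => if v 0 + v 1 + v 2 ≤ 0 then v else (fun v : EuclideanSpace ℝ (Fin 3) => ((ℝ ∙ (EuclideanSpace.single 0 1 + EuclideanSpace.single 1 1 + EuclideanSpace.single 2 1 : EuclideanSpace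 ℝ (Fin 3)))ᗮ).reflection v) v) (w i)))) Filter.atTop) := by
  intro ρ S hlim k
  refine ((hlim k).mono inter_subset_left).congr fun δ w hw => ?_
  have hle : ∀ i, w i 0 + w i 1 + w i 2 ≤ 0 := fun i => (hw.2 i).le
  -- pointwise in `δ`: `rescaledCorrelator (criticalCorr 3) ρ k δ w = ρ δ ^ k * replicaFold δ k w`
  show rescaledCorrelator (criticalCorr 3) ρ k δ w = _
  rw [rescaledCorrelator_apply]
  congr 1
  -- the `limsup` over boxes is the box limit `criticalCorr 3 k [w/δ]` of the bulk correlator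
  refine (Filter.Tendsto.limsup_eq ?_).symm
  refine (tendsto_twistCorr_zero_right 0 k _ 0).congr fun L => ?_
  -- all points are OLD: the fold is the identity, the NEW monomial is `1`, the conditional factor is `Z'/Z'`
  simp only [hle, if_true, Finset.prod_const_one, one_mul]
  rw [← gibbsAvg_nn_eq_twistCorr_u]
  refine congrArg (PairIsing.gibbsAvg _) (funext fun s => ?_)
  rw [div_self (sum_filter_gibbsWeight_ne_zero_u _ _ _), mul_one]

end Summit.CriticalPhenomena.Ising3DConformalLimit.Cruxes.TwinTransparency.ReplicaMirror

end
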